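import Summits.BirchSwinnertonDyer.BirchSwinnertonDyer.Theorems.ClassRecordThreeCartanCuspRowNormOne
import HarnessLib

/-!
# The cuspidal row of `GL₂(𝔽_q)`, III: (CTT) the cuspidal torus type at every odd prime and (RCG) the rational-cuspidal-ghost lemma PROVED — realform §N.4, §N.2 (RCG), §O.6–§O.7

Lift-only port (cell bsd-stepL, SUMMON key `ghostlift`, director-bsd (837) «(κ2) GHOSTLIFT: GO NOW» 2026-08-31; lift by tam3-p1 g43) of §N.4 (source lines 1415–1465), the (RCG) definition of §N.2 (lines 1322–1340) and §O.6–§O.7 (lines 1969–2124) of the crux-ideate workfile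
`Summits/BirchSwinnertonDyer/BirchSwinnertonDyer/Cruxes/CartanOnePlaceDegreeLawAtThree/Lines/realform.lean` (lineage `cruxidea-stmt-BirchSwinnertonDyer-24801-1`, generation 29, commit 91f4f181dd15, sha256-16 989f1973431c01d3, 2699 l.; farm rc 0, sorries 5 = its §4 stubs, none of which is lifted; referee FULL BATTERY PASS `VERDICT-REALFORM-G29-g94.md`, §O ≡ generation 28's `Lines/cusprow.lean` §O byte-identical, referee `VERDICT-CUSPROW-G28-g93.md`).
AUTHORS OF THE BYTES: cruxidea-24801 generation 27 (`ghost`: §N.2 (RCG) statement, §N.4) and generation 28 (`cusprow`: §O.6–§O.7) — carried verbatim by generation 29 (`realform`). Declarations, statements and proofs below are token-identical to the source; the only edits are the namespace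
(`…Cruxes.CartanOnePlaceDegreeLawAtThree.Realform` ↦ `…Theorems.CartanDoubleCoset`, shared with the `ClassRecordThreeCartanSupply*` lift modules), the imports ∕ `open`s ∕
section preamble each module needs, and one-line docstrings added where the source had none. Nothing is re-stated, weakened or re-proved.

CONTENT. §N.4 THE ARITHMETIC OF THE GHOST (Niven's step): a primitive `n`-th root of unity with `ζ + ζ⁻¹ ∈ ℤ` has `n ∣ 4 ∨ n ∣ 6` (`dvd_four_or_dvd_six_of_intTrace`),
and `q ≡ 1 (3)`, `3 ≤ n ∣ q + 1`, `n ∣ 4 ∨ n ∣ 6` force `q ≡ 3 (4)` (`mod_four_eq_three_of_ghostOrder`). §N.2 the statement (RCG) `RationalCuspidalGhost : Prop` (token for token;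
it travels ONLY together with its kernel-closed witness below — critic A287 (n1); its print citations are recorded on the witness). §O.6 (CTT) AT EVERY ODD PRIME by
orthogonality COUNTING, no character table (`gen_not_isScalar`, `cuspidalTorusType_of_ne_two`: an irreducible `W` with a non-zero `T_η`-fixed vector and no non-zero
`N`-fixed vector has trace `−(ζ + ζ⁻¹)` at a generator of `T_η`, `ζ` primitive of order `3 ≤ n ∣ q + 1`). §O.7 (RCG) PROVED: `rationalCuspidalGhost : RationalCuspidalGhost`.
This is the module the registry file `Cruxes/CartanOnePlaceDegreeLawAtThree/Lines/jacquet.lean` (rev 11) consumes `rationalCuspidalGhost` from (via `…Theorems.ClassRecordThreeCartanCuspRow`).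
(RCG)'s print references, moved here VERBATIM from the definition's docstring (realform l.1331) — the only docstring edit of the lift; declaration and proof tokens unchanged:
[cite: Bump1997, §4.1 Thm. 4.1.1 p. 406, Prop. 4.1.3, Prop. 4.1.6] [cite: FultonHarris1991, §5.2] [cite: Bump1997, Prop. 4.1.5, Prop. 4.1.6 p. 407] [cite: JamesLiebeck2001, Thm. 28.5]

HONEST: a `--supports stmt-BirchSwinnertonDyer-24801 --as helper` module of PROVED finite-group theory ∕ lattice bookkeeping; it closes NO registered stub and NO leaf of
24801 — the five stubs of registry `Lines/jacquet.lean` rev 10.1 ((JV) · (NCB) · (CV♭) · (DS) ∧ (JLᶜ) · (MO1ᴾ)) stand, the registry is untouched by this module, no count moves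
(1∕12 · 0∕12), nothing about NUM ∕ NUM♮ ∕ 24801 ∕ 32276 ∕ 19109 is proved for any curve; BSD is proved for no curve.
-/

set_option linter.dupNamespace false  -- `Summit.BirchSwinnertonDyer.BirchSwinnertonDyer.…` (summit = problem), as every file of this directory
set_option autoImplicit false

noncomputable section

open scoped Classical MatrixGroups
open Matrix

namespace Summit.BirchSwinnertonDyer.BirchSwinnertonDyer.Theorems.CartanDoubleCoset

open Summit.BirchSwinnertonDyer.BirchSwinnertonDyer.Theorems
open Summit.BirchSwinnertonDyer.BirchSwinnertonDyer.Theorems.CartanDegree (HasRatEigenvalue)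
open Summit.BirchSwinnertonDyer.BirchSwinnertonDyer.Theorems.CartanTorusCubeCut (torusSubgroup mem_torusSubgroup lin linGL
  linGL_coe lin_comm torusSubgroup_isCyclic card_torusSubgroup)
open Summit.BirchSwinnertonDyer.BirchSwinnertonDyer.Theorems.CartanCover (splitGen mem_splitTorus_iff)
open Summit.BirchSwinnertonDyer.BirchSwinnertonDyer.Theorems.CartanCover.Charext.InertHecke (upperUnip lowerUnip coe_upperUnip
  coe_lowerUnip upperUnip_mul upperUnip_zero exists_unip_factorization)
open Summit.BirchSwinnertonDyer.BirchSwinnertonDyer.Theorems.CartanCover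
open Summit.BirchSwinnertonDyer.BirchSwinnertonDyer.Theorems.CartanTorusCubeCut

section Ghost

variable {q : ℕ} [Fact q.Prime]

/-! ### §N.4 PROVED: THE ARITHMETIC OF THE GHOST — (CTT) ⟹ (RCG). A rational `−(ζ + ζ⁻¹)` forces `ord ζ ∣ 4 ∨ ord ζ ∣ 6` (the five integers `m ∈ [−2, 2]`,
i.e. Niven's list `{1, 2, 3, 4, 6}`), and `3 ≤ n ∣ q + 1` with `q ≡ 1 (3)` then forces `n = 4 ∣ q + 1`. -/

/-- **PROVED (Niven's step, algebraic form).** If a primitive `n`-th root of unity `ζ ∈ ℂ` (`0 < n`) has `ζ + ζ⁻¹ = m ∈ ℤ`, then `n ∣ 4` or `n ∣ 6`: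
`|m| ≤ 2` by `‖ζ‖ = 1`, and each of the five quadratics `ζ² − mζ + 1 = 0` gives `ζ⁴ = 1` or `ζ⁶ = 1`. -/
theorem dvd_four_or_dvd_six_of_intTrace {n : ℕ} {ζ : ℂ} (hζ : IsPrimitiveRoot ζ n) (hn : 0 < n) {m : ℤ}
    (hm : ζ + ζ⁻¹ = (m : ℂ)) : n ∣ 4 ∨ n ∣ 6 := by
  have hζ0 : ζ ≠ 0 := hζ.ne_zero hn.ne'
  have hnorm : ‖ζ‖ = 1 := hζ.norm'_eq_one hn.ne'
  have hm2 : |m| ≤ 2 := by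
    have h1 : ‖(m : ℂ)‖ ≤ 2 := by
      rw [← hm]
      calc ‖ζ + ζ⁻¹‖ ≤ ‖ζ‖ + ‖ζ⁻¹‖ := norm_add_le _ _
        _ = 2 := by rw [norm_inv, hnorm]; norm_num
    have h2 : ‖(m : ℂ)‖ = |(m : ℝ)| := by
      rw [← Complex.ofReal_intCast, Complex.norm_real, Real.norm_eq_abs]
    rw [h2] at h1
    have h3 : ((|m| : ℤ) : ℝ) ≤ 2 := by rw [Int.cast_abs]; exact h1
    exact_mod_cast h3
  have hquad : ζ ^ 2 + 1 = (m : ℂ) * ζ := by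
    have h : (ζ + ζ⁻¹) * ζ = (m : ℂ) * ζ := by rw [hm]
    rw [add_mul, inv_mul_cancel₀ hζ0] at h
    linear_combination h
  obtain ⟨hlo, hhi⟩ := abs_le.mp hm2
  interval_cases m
  · -- `m = -2`: `ζ = -1`
    have h0 : (ζ + 1) ^ 2 = 0 := by push_cast at hquad; linear_combination hquad
    have h1 : ζ = -1 := by have := pow_eq_zero_iff (two_ne_zero) |>.mp h0; linear_combination this
    exact Or.inl (dvd_trans (hζ.dvd_of_pow_eq_one 2 (by rw [h1]; norm_num)) (by norm_num))
  · -- `m = -1`: `ζ³ = 1`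
    have h1 : ζ ^ 3 = 1 := by push_cast at hquad; linear_combination (ζ - 1) * hquad
    exact Or.inr (dvd_trans (hζ.dvd_of_pow_eq_one 3 h1) (by norm_num))
  · -- `m = 0`: `ζ⁴ = 1`
    have h1 : ζ ^ 4 = 1 := by push_cast at hquad; linear_combination (ζ ^ 2 - 1) * hquad
    exact Or.inl (hζ.dvd_of_pow_eq_one 4 h1)
  · -- `m = 1`: `ζ⁶ = 1`
    have h1 : ζ ^ 6 = 1 := by push_cast at hquad; linear_combination (ζ ^ 4 + ζ ^ 3 - ζ - 1) * hquad
    exact Or.inr (hζ.dvd_of_pow_eq_one 6 h1)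
  · -- `m = 2`: `ζ = 1`
    have h0 : (ζ - 1) ^ 2 = 0 := by push_cast at hquad; linear_combination hquad
    have h1 : ζ = 1 := by have := pow_eq_zero_iff (two_ne_zero) |>.mp h0; linear_combination this
    exact Or.inl (dvd_trans (hζ.dvd_of_pow_eq_one 1 (by rw [h1]; norm_num)) (by norm_num))

/-- **PROVED (the residue-class step).** `q ≡ 1 (3)`, `3 ≤ n ∣ q + 1` and `n ∣ 4 ∨ n ∣ 6` force `n = 4`, hence `q ≡ 3 (mod 4)`. -/
theorem mod_four_eq_three_of_ghostOrder {q n : ℕ} (h1 : q % 3 = 1) (hn3 : 3 ≤ n) (hnq : n ∣ q + 1) (h46 : n ∣ 4 ∨ n ∣ 6) :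
    q % 4 = 3 := by
  rcases h46 with h4 | h6
  · have hn4 : n ≤ 4 := Nat.le_of_dvd (by norm_num) h4
    interval_cases n <;> omega
  · have hn6 : n ≤ 6 := Nat.le_of_dvd (by norm_num) h6
    interval_cases n <;> omega

/-- **(RCG) THE RATIONAL-CUSPIDAL-GHOST LEMMA** [NEW LEAF; FINITE GROUP THEORY of `GL₂(𝔽_q)`; `V`-free, class-free, type-free; ATTACKABLE in tree]. For a prime
`q ≡ 1 (3)` and `eta` without rational eigenvalue (so `torusSubgroup eta = T_η` is a non-split Cartan subgroup, containing the centre): an IRREDUCIBLE finite-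
dimensional complex representation `W` of `GL₂(𝔽_q)` that (i) has a non-zero `T_η`-fixed vector, (ii) has INTEGER-valued character, and (iii) has NO non-zero
vector fixed by the unipotent radical `N = {n(y)}`, can exist only if `q ≡ 3 (mod 4)`. Print proof: (iii) + irreducible ⟹ `W` is cuspidal, `W ≅ π(ν)` for a regular
character `ν` of `𝔽_{q²}^×` (every non-cuspidal irreducible — `χ∘det`, `χ·St`, `PS(χ₁, χ₂)` — has `N`-fixed vectors); (i) ⟹ the trivial character of `T_η` occurs
in `π(ν)|_{T_η} = ⊕ {θ : θ|_Z = ν|_Z, θ ∉ {ν, ν^q}}`, so `ν|_{𝔽_q^×} = 1` and `ν` is a character of the cyclic group `𝔽_{q²}^× ∕ 𝔽_q^×` of order `q + 1`, of some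
order `n ≥ 3` (regularity: `ν^q = ν⁻¹ ≠ ν`); (ii) on an elliptic element with eigenvalue a generator: `−(ζ_n + ζ_n⁻¹) ∈ ℤ` ⟹ `φ(n) ≤ 2` ⟹ `n ∈ {3, 4, 6}`; `n ∣ q+1`
and `q ≡ 1 (3)` ⟹ `3 ∤ q + 1` ⟹ `n = 4` ⟹ `4 ∣ q + 1`. (At `q ≡ 7 (12)` the ghost `π(ν₄)` does satisfy (i)–(iii): the lemma is sharp.) Why it might fail: it
cannot (a theorem of the character table); as TYPED the only risk is a convention slip in `torusSubgroup` (it contains the centre — needed for (i) ⟹ `ω = 1`).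
(Print references: Bump 1997 §4.1 Thm. 4.1.1 p. 406, Props. 4.1.3 ∕ 4.1.5 ∕ 4.1.6 p. 407; Fulton–Harris 1991 §5.2; James–Liebeck 2001 Thm. 28.5 — the source's four cite TAGS on this
definition are carried in the MODULE docstring instead: a cite-tagged parameter-free `def … : Prop` is read by the gate as an inline Literature fact and relocated, p827008 ∕ p827009.) -/
def RationalCuspidalGhost : Prop :=
  ∀ (q : ℕ) [Fact q.Prime], q % 3 = 1 →
    ∀ (eta : Matrix (Fin 2) (Fin 2) (ZMod q)), ¬ HasRatEigenvalue eta →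
    ∀ (W : Type) [AddCommGroup W] [Module ℂ W] [Module.Finite ℂ W] (ρ : Representation ℂ (GL (Fin 2) (ZMod q)) W),
      (∀ W' : Submodule ℂ W, (∀ g : GL (Fin 2) (ZMod q), ∀ w ∈ W', ρ g w ∈ W') → W' = ⊥ ∨ W' = ⊤) →
      (∃ u : W, u ≠ 0 ∧ ∀ t ∈ CartanTorusCubeCut.torusSubgroup eta, ρ t u = u) →
      (∀ g : GL (Fin 2) (ZMod q), ∃ n : ℤ, LinearMap.trace ℂ W (ρ g) = (n : ℂ)) →
      (∀ w : W, (∀ y : ZMod q, ρ (upperUnip y) w = w) → w = 0) →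
      q % 4 = 3

end Ghost

section Cusprow

open Representation (IntertwiningMap)
open Summit.BirchSwinnertonDyer.BirchSwinnertonDyer.Theorems.CartanTorusCubeCut (G Mat)
open Summit.BirchSwinnertonDyer.BirchSwinnertonDyer.Theorems.CartanSupply.Monomial
open Summit.BirchSwinnertonDyer.BirchSwinnertonDyer.Theorems.CartanSupply.VirtualCharacter (exists_irreducible_of_virtual_normOne
  sum_char_mul_char_inv)

variable {q : ℕ} [Fact q.Prime]

variable {eta : Mat q}

/-! ### §O.6 THE CUSPIDAL TORUS TYPE (CTT) AT EVERY ODD PRIME — by orthogonality COUNTING, no character table: `Σ_θ a_θ = dim W = Σ_ψ b_ψ`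
(`a_θ := dim Hom_{T_η}(θ, W)`, `b_ψ := dim Hom_{ZN}(ψ, W)`), `a_1 ≥ 1` (the fixed vector), `b_1 = 0` (cuspidality), and for every regular `ν` with `ν|_Z = 1`
the pairing `⟨χ_W, χ_{U_ν}⟩ = b_{ψ} − a_ν`; if all these vanished, `Σ_θ a_θ ≥ 1 + (q − 1)·max_ψ b_ψ > dim W`. So `W ≅ U_ν` for some regular `ν`, and
`χ_W(gen T_η) = −(ν(gen) + ν(gen)⁻¹)`. -/

/-- a generator of the cyclic group `T_η` (order `q² − 1`) is not a scalar matrix (scalars have order `∣ q − 1`). -/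
theorem gen_not_isScalar (hη : ¬ HasRatEigenvalue eta) :
    ¬ CartanDegree.IsScalarMat (((gen (torusSubgroup_isCyclic hη) : torusSubgroup eta) : G q) : Mat q) := by
  intro hs
  have hpr := (Fact.out : q.Prime)
  have hpos : 0 < q - 1 := Nat.sub_pos_of_lt hpr.one_lt
  have h1 : gen (torusSubgroup_isCyclic hη) ^ (q - 1) = 1 :=
    Subtype.ext (by rw [Subgroup.coe_pow, Subgroup.coe_one]; exact pow_card_sub_one_of_isScalar hs)
  have h2 : orderOf (gen (torusSubgroup_isCyclic hη)) ∣ q - 1 := orderOf_dvd_of_pow_eq_one h1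
  rw [orderOf_gen hη, card_torusSubgroup hη] at h2
  have h3 := Nat.le_of_dvd hpos h2
  have h4 : (q - 1) * 2 ≤ (q - 1) * (q + 1) := Nat.mul_le_mul_left _ (by omega)
  have h5 : (q - 1) * 2 ≤ (q - 1) * 1 := by rw [mul_one]; exact h4.trans h3
  have h6 := Nat.le_of_mul_le_mul_left h5 hpos
  omega

/-- **(CTT) at `q ≠ 2`, PROVED.** An irreducible `W` with a non-zero `T_η`-fixed vector and no non-zero `N`-fixed vector has trace `−(ζ + ζ⁻¹)` at a generator
of `T_η`, `ζ` a primitive `n`-th root of unity with `3 ≤ n ∣ q + 1`. -/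
theorem cuspidalTorusType_of_ne_two (hq2 : q ≠ 2) (eta : Mat q) (hη : ¬ HasRatEigenvalue eta)
    (W : Type) [AddCommGroup W] [Module ℂ W] [Module.Finite ℂ W] (ρ : Representation ℂ (G q) W)
    (hirr : ∀ W' : Submodule ℂ W, (∀ g : G q, ∀ w ∈ W', ρ g w ∈ W') → W' = ⊥ ∨ W' = ⊤)
    (hfix : ∃ u : W, u ≠ 0 ∧ ∀ t ∈ torusSubgroup eta, ρ t u = u)
    (hcusp : ∀ w : W, (∀ y : ZMod q, ρ (upperUnip y) w = w) → w = 0) :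
    ∃ t ∈ torusSubgroup eta, ∃ (n : ℕ) (ζ : ℂ), 3 ≤ n ∧ n ∣ q + 1 ∧ IsPrimitiveRoot ζ n ∧ LinearMap.trace ℂ W (ρ t) = -(ζ + ζ⁻¹) := by
  have hpr := (Fact.out : q.Prime)
  have hq1 : 0 < q - 1 := Nat.sub_pos_of_lt hpr.one_lt
  obtain ⟨u, hu0, hu⟩ := hfix
  have hZ : ∀ (a : (ZMod q)ˣ) (w : W), ρ (Charext.scalarGL a) w = w := scalar_trivial ρ hirr hu0 hu
  have hN : Fintype.card (torusSubgroup eta) = (q - 1) * (q + 1) := card_torusSubgroup hη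
  have hNpos : 0 < Fintype.card (torusSubgroup eta) := Fintype.card_pos
  -- the two counts
  have ha := sum_hom_torus_eq ρ hη
  have hb := sum_hom_zn_eq ρ hZ
  have ha0 := hom_torus_zero_pos ρ hη hu0 hu
  have hb0 := hom_zn_zero ρ hcusp
  -- `j₀` maximising `b`, `m := b_{j₀}`: `dim W ≤ (q - 1)·m`, so `m ≥ 1`, `j₀ ≠ 0`
  obtain ⟨j₀, -, hj₀⟩ := Finset.exists_max_image (Finset.univ : Finset (ZMod q))
    (fun j => Module.finrank ℂ (IntertwiningMap (lineRep (znChar ((ψq (q := q)).mulShift j))) (res ρ (znSub q)))) Finset.univ_nonempty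
  set m := Module.finrank ℂ (IntertwiningMap (lineRep (znChar ((ψq (q := q)).mulShift j₀))) (res ρ (znSub q))) with hm
  have hWle : Module.finrank ℂ W ≤ (q - 1) * m := by
    rw [← hb, ← Finset.add_sum_erase _ _ (Finset.mem_univ (0 : ZMod q)), hb0, zero_add]
    refine (Finset.sum_le_card_nsmul _ _ m fun j _ => hj₀ j (Finset.mem_univ j)).trans ?_
    rw [Finset.card_erase_of_mem (Finset.mem_univ _), Finset.card_univ, ZMod.card, smul_eq_mul]
  have hWpos : 0 < Module.finrank ℂ W := Module.finrank_pos_iff_exists_ne_zero.2 ⟨u, hu0⟩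
  have hm0 : 0 < m := by
    rcases Nat.eq_zero_or_pos m with h | h
    · rw [h, mul_zero] at hWle; omega
    · exact h
  have hj₀0 : j₀ ≠ 0 := by
    rintro rfl
    rw [hm, hb0] at hm0
    exact lt_irrefl 0 hm0
  have hψ : (ψq (q := q)).mulShift j₀ ≠ 1 := ψq_isPrimitive hj₀0
  -- the regular exponents `R := {j' ∈ [1, q] : 2 j' ≠ q + 1}` (at least `q - 1` of them), `ν_{j'} := χ_{(q-1) j'}` is trivial on `Z`
  have hRcard : q - 1 ≤ ((Finset.Icc 1 q).filter (fun j' => 2 * j' ≠ q + 1)).card := by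
    have h1 := Finset.card_filter_add_card_filter_not (s := Finset.Icc 1 q) (fun j' => 2 * j' ≠ q + 1)
    rw [Nat.card_Icc] at h1
    have h2 : ((Finset.Icc 1 q).filter (fun j' => ¬ (2 * j' ≠ q + 1))).card ≤ 1 :=
      Finset.card_le_one.2 fun x hx y hy => by
        rw [Finset.mem_filter, Finset.mem_Icc] at hx hy
        omega
    omega
  set R : Finset ℕ := (Finset.Icc 1 q).filter (fun j' => 2 * j' ≠ q + 1) with hR
  -- some regular `ν_{j'}` has `a_{ν_{j'}} ≠ m`
  have hex : ∃ j' ∈ R, Module.finrank ℂ (IntertwiningMap (lineRep (chi hη ((q - 1) * j'))) (res ρ (torusSubgroup eta))) ≠ m := by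
    by_contra hall
    push Not at hall
    have h0notin : (0 : ℕ) ∉ R.image (fun j' => (q - 1) * j') := by
      intro h
      obtain ⟨j', hj', h0⟩ := Finset.mem_image.1 h
      have := (Finset.mem_Icc.1 (Finset.mem_filter.1 hj').1).1
      rcases Nat.mul_eq_zero.1 h0 with h | h <;> omega
    have hinj : ∀ x ∈ R, ∀ y ∈ R, (q - 1) * x = (q - 1) * y → x = y := fun x _ y _ h => Nat.eq_of_mul_eq_mul_left hq1 h
    have hsub : insert 0 (R.image (fun j' => (q - 1) * j')) ⊆ Finset.range (Fintype.card (torusSubgroup eta)) := by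
      intro j hj
      rw [Finset.mem_range, hN]
      rcases Finset.mem_insert.1 hj with rfl | hj
      · exact Nat.mul_pos hq1 (Nat.succ_pos q)
      · obtain ⟨j', hj', rfl⟩ := Finset.mem_image.1 hj
        have := (Finset.mem_Icc.1 (Finset.mem_filter.1 hj').1).2
        exact Nat.mul_lt_mul_of_pos_left (by omega) hq1
    have hsum : Module.finrank ℂ (IntertwiningMap (lineRep (chi hη 0)) (res ρ (torusSubgroup eta))) + R.card * m ≤ Module.finrank ℂ W := by
      calc Module.finrank ℂ (IntertwiningMap (lineRep (chi hη 0)) (res ρ (torusSubgroup eta))) + R.card * m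
          = Module.finrank ℂ (IntertwiningMap (lineRep (chi hη 0)) (res ρ (torusSubgroup eta))) +
              ∑ j' ∈ R, Module.finrank ℂ (IntertwiningMap (lineRep (chi hη ((q - 1) * j'))) (res ρ (torusSubgroup eta))) := by
            rw [Finset.sum_const_nat hall]
        _ = ∑ j ∈ insert 0 (R.image (fun j' => (q - 1) * j')),
              Module.finrank ℂ (IntertwiningMap (lineRep (chi hη j)) (res ρ (torusSubgroup eta))) := by
            rw [Finset.sum_insert h0notin, Finset.sum_image hinj]
        _ ≤ _ := Finset.sum_le_sum_of_subset hsub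
        _ = Module.finrank ℂ W := ha
    have hmul := Nat.mul_le_mul_right m hRcard
    omega
  obtain ⟨j', hj'R, hne⟩ := hex
  have hj'1 : 1 ≤ j' ∧ j' ≤ q := Finset.mem_Icc.1 (Finset.mem_filter.1 hj'R).1
  have hj'2 : 2 * j' ≠ q + 1 := (Finset.mem_filter.1 hj'R).2
  set ν : torusSubgroup eta →* ℂ := chi hη ((q - 1) * j') with hν
  have hZν : ∀ x : torusSubgroup eta, CartanDegree.IsScalarMat ((x : G q) : Mat q) → ν x = 1 := chi_scalar hη j'
  -- `ξ := rootT^(q-1)` is a primitive `(q+1)`-th root of unity and `ν(gen) = ξ^{j'} =: x` with `x ≠ 1`, `x² ≠ 1`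
  have hroot : IsPrimitiveRoot ((rootT eta : ℂˣ) : ℂ) (Fintype.card (torusSubgroup eta)) := IsPrimitiveRoot.coe_units_iff.2 (rootT_spec eta)
  have hξ : IsPrimitiveRoot (((rootT eta : ℂˣ) : ℂ) ^ (q - 1)) (q + 1) := hroot.pow hNpos hN
  set x : ℂ := (((rootT eta : ℂˣ) : ℂ) ^ (q - 1)) ^ j' with hx
  have hνgen : ν (gen (torusSubgroup_isCyclic hη)) = x := by rw [hν, chi_apply, faith_gen, pow_mul]
  have hx1 : x ≠ 1 := by
    intro h
    have hd := (hξ.pow_eq_one_iff_dvd j').1 h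
    have := Nat.le_of_dvd (by omega) hd
    omega
  have hx2 : x ^ 2 ≠ 1 := by
    intro h
    rw [hx, ← pow_mul] at h
    obtain ⟨k, hk⟩ := (hξ.pow_eq_one_iff_dvd (j' * 2)).1 h
    rcases Nat.lt_or_ge k 2 with hk2 | hk2
    · interval_cases k <;> omega
    · have : (q + 1) * 2 ≤ (q + 1) * k := Nat.mul_le_mul_left _ hk2
      omega
  have hxq : x ^ (q + 1) = 1 := by rw [hx, ← pow_mul, mul_comm, pow_mul, hξ.pow_eq_one, one_pow]
  -- `W ≅ U_ν`
  obtain ⟨U, _, _, _, ρU, hUirr, hχU⟩ := exists_irreducible_cuspRow hq2 hη hψ ν hZν ⟨gen (torusSubgroup_isCyclic hη), by rw [hνgen]; exact hx2⟩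
  have hpair : ∑ g : G q, ρ.character g * ρU.character g⁻¹ ≠ 0 := by
    have hrw : ∀ g : G q, ρ.character g * ρU.character g⁻¹ =
        ρ.character g * (monRep (znSub q) (znChar ((ψq (q := q)).mulShift j₀))).character g⁻¹ -
          ρ.character g * (monRep (torusSubgroup eta) ν).character g⁻¹ := by
      intro g; rw [hχU, mul_sub]
    simp_rw [hrw]
    rw [Finset.sum_sub_distrib, frobenius_reciprocity, frobenius_reciprocity, ← mul_sub]
    refine mul_ne_zero (by exact_mod_cast Fintype.card_ne_zero) (sub_ne_zero.2 ?_)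
    exact_mod_cast hne.symm
  have hchar := char_eq_of_pairing_ne_zero ρU ρ hUirr hirr hpair
  have hgns := gen_not_isScalar hη
  refine ⟨((gen (torusSubgroup_isCyclic hη) : torusSubgroup eta) : G q), (gen (torusSubgroup_isCyclic hη)).2, orderOf x, x, ?_,
    orderOf_dvd_of_pow_eq_one hxq, IsPrimitiveRoot.orderOf x, ?_⟩
  · have ho0 : 0 < orderOf x := orderOf_pos_iff.2 (isOfFinOrder_iff_pow_eq_one.2 ⟨q + 1, Nat.succ_pos q, hxq⟩)
    have ho1 : orderOf x ≠ 1 := fun h => hx1 (orderOf_eq_one_iff.1 h)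
    have ho2 : orderOf x ≠ 2 := fun h => hx2 (by rw [← h, pow_orderOf_eq_one])
    omega
  · change ρ.character _ = _
    rw [hchar, hχU, valA_torus hq2 hη _ (gen (torusSubgroup_isCyclic hη)).2 hgns, valB_torus hq2 hη ν hZν (gen (torusSubgroup_isCyclic hη)).2 hgns,
      zero_sub, Subtype.coe_eta, hνgen]

/-! ### §O.7 (RCG) PROVED: generation 27's rational-ghost lemma is a theorem — (CTT) at `q ≠ 2` (§O.6) + the arithmetic of §N.4 (`q ≡ 1 (3)` forces `q ≠ 2`) -/

/-- **(RCG) `RationalCuspidalGhost`, PROVED** (generation 27's `stub_cuspidalTorusType` ∘ `rationalCuspidalGhost_of_type`, now sorry-free): a rational-charactered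
irreducible `W` of `GL₂(𝔽_q)`, `q ≡ 1 (3)`, with a `T_η`-fixed vector and no `N`-fixed vector forces `q ≡ 3 (mod 4)`. -/
theorem rationalCuspidalGhost : RationalCuspidalGhost := by
  intro q _ h1 eta hη W _ _ _ ρ hirr hfix htr hcusp
  obtain ⟨t, -, n, ζ, hn3, hnq, hζ, htrace⟩ := cuspidalTorusType_of_ne_two (by omega) eta hη W ρ hirr hfix hcusp
  obtain ⟨m, hm⟩ := htr t
  have hsum : ζ + ζ⁻¹ = ((-m : ℤ) : ℂ) := by
    rw [Int.cast_neg, ← hm, htrace, neg_neg]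
  exact mod_four_eq_three_of_ghostOrder h1 hn3 hnq (dvd_four_or_dvd_six_of_intTrace hζ (by omega) hsum)

end Cusprow

end Summit.BirchSwinnertonDyer.BirchSwinnertonDyer.Theorems.CartanDoubleCoset

end
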